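import Summits.BirchSwinnertonDyer.BirchSwinnertonDyer.Theses.KatoDescentPotSupersingular
import Summits.BirchSwinnertonDyer.BirchSwinnertonDyer.Theorems.KatoDescentPotSupersingularWildJetchevBoundAtPOfStubs
import Summits.BirchSwinnertonDyer.BirchSwinnertonDyer.Theorems.KatoDescentPotSupersingularWildJetchevBoundAtPCoreVertexBridgePrimed
import Summits.BirchSwinnertonDyer.BirchSwinnertonDyer.Theorems.KatoDescentPotSupersingularWildJetchevBoundAtPClosedLocalFacts
import Summits.BirchSwinnertonDyer.BirchSwinnertonDyer.Theorems.Rank1ResidualJetRingClassFields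
import HarnessLib

/-!
**ADOPTED as skeleton v4 by planner bsd-potss-plan g23 (2026-08-27T11:55Z)** — k9-c4 g8's candidate
(`pub/bsd-potss/k9-c4/g8/WildJetchevBoundAtP_birth_v4_candidate.lean`, sha16 9bbfc3f5f460c989) byte-identical below this
note EXCEPT one syntactic repair (a stray orphan docstring «Statement of `stub_publishedInputsHeegner` (cite) … byte-identical
to v1» left before `Sig.S2pDivisibilityAtP` with no declaration under it — an «unexpected token: doc-comment opener» error at the
candidate's l. 313 — deleted; the real `Sig.stub_publishedInputsHeegner` block further down is untouched); supersedes the registered v3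
(sha 805451dd0dcc, archived `Lines/v3_kernelGapsAtP_g22.lean`, ns `.BirthV3`). `lean check` rc 0, seven `sorry`s = seven
stubs (= stubs_max; six after the queued `d_K ≠ −4` restate drops `stub_gaussianSupplement`), `WildJetchevBoundAtP_of` a
REAL proof concluding the K9 decl by name. ALL SIX load-bearing stubs (S1, S2′, S3′, S5, S6 `stub_thm52ClosedLocalFacts`,
S7) are now byte-identical (up to one space of indentation in S2′/S3′, same terms) with 20165 v6 — one proof per stub
`--supports` both items. PLANNED v5 CUT: as 20165 v7 (S6 ↦ S6a published local inputs hPT/h53/hGZ + S6b local gaps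
hloc/h𝒯σ/h𝒯sd/htr/h49str) at the `d_K ≠ −4` restate.
-/

/-!
# BC3 SKELETON v4 CANDIDATE (prover-written for the planner; = registered v3 with `stub_thm52KernelGapsAtP` REPLACED by k8t-c4 g10's
# `stub_thm52ClosedLocalFacts` — BYTE-IDENTICAL with 20165 v6 candidate — through `thm63AtP_of_closedLocalFactsAtP` (p528465)) — crux `WildJetchevBoundAtP` (item
# stmt-BirchSwinnertonDyer-19941; route K9 = `Theses/KatoDescentPotSupersingular.lean`, rank 6); seat `bsd-potss-k9-c4` g8,
# 2026-08-27; supersedes v1 (`Lines/birth.lean` fa288a46e054: S1′ `stub_structure_depth_indexForm_d3` / S2′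
# `stub_derivedPoint_divisible_at_additive_p`) IF the planner adopts it (only the planner's unit may `crux write`)

WHY v2. Three kernel files of k9-c4 g8 (all ACCEPTED, route-free except the first which imports the K9 route for the
by-name §3): p518161 `…WildJetchevBoundAtPOfStubs` (the crux BY NAME from S1 + S2p + `PublishedInputsHeegner` + the
displayed `d_K = −4` supplement), p518685 `…WildJetchevBoundAtPSkeletonRekey` (v1's S1′/S2′ at `d_K ≠ −4` ⟸ S1 / S2p),
p520230 `…WildJetchevBoundAtPCoreVertexBridge` (S2p ⟸ prop52Irred + coreVertexExistenceIrred + hRCF + H63Ip; H63Ip ⟸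
cor32Irred + prop44Irred + KernelGapsAtP, via k8t-c4's carrier-abstract assembly p508713 at `t := ord_p c_p`). So the
crux REDUCES to the shared crux 20165's registered stubs (skeleton v3: `stub_structureIrred`, `stub_prop52Irred`,
`stub_coreVertexExistenceIrred`, `stub_cor32Irred`, `stub_prop44Irred` — VERBATIM, same `Sig` bodies; a proof of any
of them for 20165 is a proof here) + ONE new statement `stub_thm52KernelGapsAtP` (20165's `stub_thm52KernelGapsAddv`
with the carrier moved to `p`) + the held `PublishedInputsHeegner` + the idle Gaussian-field supplement
`stub_gaussianSupplement` (the crux body at `d_K = −4`; DROP IT by adding the binder `NumberField.discr K ≠ -4` to the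
crux — its one consumer, the J08 road, applies `hJp` at a BFH field with `d_K < −4`; then this skeleton has exactly
20165's seven stub slots). READING behind the cut (FINDING-19941 memo): the `q = p` carrier is bsd-jet's road K4
`JET.JetchevDivisibilityCarrierAdd` read with `E[p]` irreducible; Jetchev's Lemma 4.3 at `v ∣ p` is replaced by
x11b3's connected-Kummer layer theorem mod [GZ III (3.1)], the Thm 6.3 local quotient is `Φ_v(𝔽_p)/p^m`; §§5–6 are
carrier-blind — so 19941 is NOT beyond Jetchev's method, it is the B-row instance of the same reading as 20165.
v4: `stub_thm52KernelGapsAtP` ↦ `stub_thm52ClosedLocalFacts` (8 closed statements, shared with 20165 v6; p525480/p528465: the H63 structures and Φ-cyclicity are tree theorems); v2.1: `stub_cor32Irred` DROPPED (k8t-c4 g9: h32I false as displayed, its row form a THEOREM p516209; Čebotarev-free assembly p519470) and `stub_prop52Irred`/`stub_coreVertexExistenceIrred` ↦ the PRIMED `…P` forms of 20165 v5 (plan g22 `…v5_primedSigs.lean`, bridge re-issue p521540, K9 twin p522249). `WildJetchevBoundAtP_of` is a REAL proof; `lean check`: sorries ONLY in `stub_*` (7 = stubs_max; 6 after the `d_K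 ≠ −4` restatement).
HONEST FRAMING: conditional throughout; nothing booked; the crux, its stubs and BSD are as open as before.

References: [cite: Jetchev2008, Conj. 1.3, Thm. 1.4, Cor. 1.5, Lemma 4.3, Def. 4.8, Prop. 4.9, Thm. 5.1, Thm. 5.2 (p. 821), Prop. 5.3, Rem. 6.2]
[cite: MatarNekovar2019, Thm. 0.7, §0.11] [cite: McCallumLMS1991, §3 Cor. 3.2, §4 Prop. 4.4, §5 Prop. 5.2, Lemma 5.1, Cor. 5.6]
[cite: GrossLMS1991, §3, Prop. 5.3, Prop. 6.2 (1)] [cite: GrossZagier1986, III (3.1)] [cite: MilneADT2006, I Prop. 3.8]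
-/

set_option linter.dupNamespace false
set_option autoImplicit false

noncomputable section

open scoped Classical NumberField Pointwise

open WeierstrassCurve IsDedekindDomain NumberField Literature.NumberTheory.EllipticCurves
  Literature.NumberTheory.EllipticCurves.ModularForms Literature.NumberTheory.EllipticCurves.Jetchev2008
  Literature.NumberTheory.EllipticCurves.Rank1Residual
  Literature.NumberTheory.GaloisRepresentations
  Literature.NumberTheory.GaloisRepresentations.DiscreteGaloisModule
  Summit.BirchSwinnertonDyer.Rank1Residual Summit.BirchSwinnertonDyer.Rank1Residual.X11b
  Summit.BirchSwinnertonDyer.Rank1Residual.JET Summit.BirchSwinnertonDyer.Rank1Residual.JET.SelmerVocabulary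
  Summit.BirchSwinnertonDyer.Rank1Residual.X11b.Three Literature.NumberTheory.GaloisCohomology Field
  Literature.NumberTheory.Automorphic
  Summit.BirchSwinnertonDyer.BirchSwinnertonDyer.Theorems

namespace Summit.BirchSwinnertonDyer.BirchSwinnertonDyer.Cruxes.WildJetchevBoundAtP.BirthV4

/-- Statement of `stub_structureIrred` (S1): Kolyvagin's structure theorem, UPPER half, under IRREDUCIBILITY of
`E[p]`, with NO reduction-type binder at `p` (McCallum currency): `ord_p #Ш(E/K)[p^∞] + 2t ≤ 2M₀`
(`p^{M₀} ∥ y_K` in `E(K)`) when every derived Heegner point is `p^s`-divisible at every depth `s ≤ t`.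
= `Cha2005.rmk25_padicValNat_card_sha_primary_add_le_of_globalDivisibility` minus `p ∤ d_K`, `p² ∤ N`
(Matar–Nekovář 2019 Thm. 0.7 + §0.11; McCallum 1991 Cor. 5.6). -/
abbrev Sig.stub_structureIrred : Prop :=
  ∀ (W : WeierstrassCurve ℚ) [W.IsElliptic] [W.IsGloballyMinimal] [NeZero (W.conductorNorm ℤ)],
    ¬ W.HasCM →
    ∀ (K : Type) [Field K] [NumberField K], IsImaginaryQuadratic K →
    NumberField.discr K ≠ -3 → NumberField.discr K ≠ -4 →
    SatisfiesHeegnerHypothesis (W.conductorNorm ℤ) K →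
    ∀ (p : ℕ) [Fact p.Prime], p ≠ 2 → W.HasIrreducibleModPGaloisRep p →
    ∀ (Dt : ModularParametrizationData W (W.conductorNorm ℤ)) (β : ℤ) (ι : K →+* ℂ)
      (d₁ : KolyvaginHeegnerData Dt β ι 1) (P : (W.baseChange K).toAffine.Point),
      d₁.toGeomPoints d₁.derivedPoint = toGeomPoints (W.baseChange K) P →
      ¬ IsOfFinAddOrder P →
    ∀ (M₀ : ℕ),
      (∃ Q : (W.baseChange K).toAffine.Point, ((p ^ M₀ : ℕ) : ℤ) • Q = P) →
      (¬ ∃ Q : (W.baseChange K).toAffine.Point, ((p ^ (M₀ + 1) : ℕ) : ℤ) • Q = P) →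
    ∀ (t : ℕ),
      (∀ (s : ℕ), s ≤ t → ∀ (n : ℕ) (d : KolyvaginHeegnerData Dt β ι n), Squarefree n →
        (∀ ℓ ∈ n.primeFactors, Zhang2014.IsKolyvaginPrime (W.conductorNorm ℤ) W K p ℓ ∧
          s ≤ Zhang2014.kolyvaginIndex W p ℓ) →
        ∃ Q : (W.baseChange (ringClassField K ι n)).toAffine.Point,
          ((p ^ s : ℕ) : ℤ) • Q = d.derivedPoint) →
    padicValNat p (Nat.card (AddCommGroup.primaryComponent (W.baseChange K).sha p)) + 2 * t ≤ 2 * M₀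

/-- Statement of `stub_prop52Irred`: McCallum 1991 Prop. 5.2 («`M_r < M ⟹ ∃ c ∈ Λ^r_M` with `ord P(c)` of exact order `p^{M−M_r}`») in the IRREDUCIBLE reading — the `p`-adic-tower / surjectivity binder replaced by `W.HasIrreducibleModPGaloisRep p` (valid under absolute irreducibility by Jetchev 2008 Rem. 6.2: the proof uses the image only through the Čebotarev Cor. 3.2). VERBATIM the hypothesis `h52I` of `divisibilityIrredAddv_of_prop52Irred_of_coreVertexExistenceIrred_of_thm63` (p504855). A READING, displayed, nothing asserted. [cite: McCallumLMS1991, §5 Prop. 5.2 (p. 304), §3 Cor. 3.2] [cite: Jetchev2008, Rem. 6.2] -/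
abbrev Sig.stub_prop52IrredP : Prop :=
   ∀ (W : WeierstrassCurve ℚ) [W.IsElliptic] [W.IsGloballyMinimal] [NeZero (W.conductorNorm ℤ)],
      ¬ W.HasCM →
      ∀ (K : Type) [Field K] [NumberField K], IsImaginaryQuadratic K →
      NumberField.discr K ≠ -3 → NumberField.discr K ≠ -4 →
      SatisfiesHeegnerHypothesis (W.conductorNorm ℤ) K →
      ∀ (p : ℕ) [Fact p.Prime], p ≠ 2 → W.HasIrreducibleModPGaloisRep p → (p : ℤ) ∣ W.conductorNorm ℤ →
      ∀ (Dt : ModularParametrizationData W (W.conductorNorm ℤ)) (β : ℤ) (ι : K →+* ℂ)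
        (d₁ : KolyvaginHeegnerData Dt β ι 1), ¬ IsOfFinAddOrder d₁.derivedPoint →
      ∀ (r : ℕ), 0 < r →
      ∀ (Mr : ℕ),
        IsLeast {u : ℕ | ∃ (n : ℕ) (d : KolyvaginHeegnerData Dt β ι n), Squarefree n ∧
            n.primeFactors.card = r ∧
            (∀ ℓ ∈ n.primeFactors, Zhang2014.IsKolyvaginPrime (W.conductorNorm ℤ) W K p ℓ ∧
              u + 1 ≤ Zhang2014.kolyvaginIndex W p ℓ) ∧
            (∃ Q : (W.baseChange (ringClassField K ι n)).toAffine.Point,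
              ((p ^ u : ℕ) : ℤ) • Q = d.derivedPoint) ∧
            ¬ ∃ Q : (W.baseChange (ringClassField K ι n)).toAffine.Point,
              ((p ^ (u + 1) : ℕ) : ℤ) • Q = d.derivedPoint} Mr →
      ∀ (M : ℕ), Mr < M →
        ∃ (n : ℕ) (d : KolyvaginHeegnerData Dt β ι n), Squarefree n ∧ n.primeFactors.card = r ∧
          (∀ ℓ ∈ n.primeFactors, Zhang2014.IsKolyvaginPrime (W.conductorNorm ℤ) W K p ℓ ∧
            M ≤ Zhang2014.kolyvaginIndex W p ℓ) ∧
          addOrderOf (d.kolyvaginClass (Fact.out : p.Prime) M) = p ^ (M - Mr) ∧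
          (∃ Q : (W.baseChange (ringClassField K ι n)).toAffine.Point,
            ((p ^ Mr : ℕ) : ℤ) • Q = d.derivedPoint) ∧
          ¬ ∃ Q : (W.baseChange (ringClassField K ι n)).toAffine.Point,
            ((p ^ (Mr + 1) : ℕ) : ℤ) • Q = d.derivedPoint

/-- Statement of `stub_coreVertexExistenceIrred`: Jetchev 2008 Prop. 5.3 (= arXiv:math/0703431 Prop. 6.4: a core vertex of every level `m ≥ 1` above a conductor with non-torsion, exactly-`p^s`-divisible derived point and `s + m ≤ M(c)`) in the IRREDUCIBLE reading — bsd-jet's reading binder `JET.JetchevCoreVertexExistence` with its tower binder replaced by `W.HasIrreducibleModPGaloisRep p`. VERBATIM the hypothesis `hCVI` of p504855. A READING, displayed, nothing asserted. [cite: Jetchev2008, Prop. 5.3 (p. 823), Lemma 5.1, Rem. 6.2] -/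
abbrev Sig.stub_coreVertexExistenceIrredP : Prop :=
   ∀ (W : WeierstrassCurve ℚ) [W.IsElliptic] [W.IsGloballyMinimal] [NeZero (W.conductorNorm ℤ)],
      ¬ W.HasCM →
      ∀ (K : Type) [Field K] [NumberField K], IsImaginaryQuadratic K →
      NumberField.discr K ≠ -3 → NumberField.discr K ≠ -4 →
      SatisfiesHeegnerHypothesis (W.conductorNorm ℤ) K →
      ∀ (τ : K ≃ₐ[ℚ] K), τ ≠ 1 →
      ∀ (p : ℕ) [Fact p.Prime], p ≠ 2 → W.HasIrreducibleModPGaloisRep p → (p : ℤ) ∣ W.conductorNorm ℤ →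
      ∀ (Dt : ModularParametrizationData W (W.conductorNorm ℤ)) (β : ℤ) (ι : K →+* ℂ)
        [∀ k : ℕ, NumberField (ringClassField K ι k)]
        (d₁ : KolyvaginHeegnerData Dt β ι 1), ¬ IsOfFinAddOrder d₁.derivedPoint →
      ∀ (m : ℕ), 1 ≤ m →
      ∀ (c : ℕ) (d : KolyvaginHeegnerData Dt β ι c), Squarefree c →
        (∀ ℓ ∈ c.primeFactors, Zhang2014.IsKolyvaginPrime (W.conductorNorm ℤ) W K p ℓ) →
      ∀ (s : ℕ), ¬ IsOfFinAddOrder d.derivedPoint →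
        (∃ Q : (W.baseChange (ringClassField K ι c)).toAffine.Point,
          ((p ^ s : ℕ) : ℤ) • Q = d.derivedPoint) →
        (¬ ∃ Q : (W.baseChange (ringClassField K ι c)).toAffine.Point,
          ((p ^ (s + 1) : ℕ) : ℤ) • Q = d.derivedPoint) →
        ((s + m : ℕ) : ℕ∞) ≤ Zhang2014.levelIndex W p c →
        ∃ (c' : ℕ) (d' : KolyvaginHeegnerData Dt β ι c'), Squarefree c' ∧
          (∀ ℓ ∈ c'.primeFactors, Zhang2014.IsKolyvaginPrime (W.conductorNorm ℤ) W K p ℓ ∧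
            m + s ≤ Zhang2014.kolyvaginIndex W p ℓ) ∧
          Jetchev2008.IsGlobalCoreVertex W K ι τ p m c' ∧
          ¬ IsOfFinAddOrder d'.derivedPoint ∧
          ¬ ∃ Q : (W.baseChange (ringClassField K ι c')).toAffine.Point,
            ((p ^ (s + 1) : ℕ) : ℤ) • Q = d'.derivedPoint

/-- Statement of `stub_prop44Irred` (NEW in v3; = the hypothesis `h44I` of p508713 VERBATIM): McCallum 1991 Prop. 4.4
— at a place `λ ∣ ℓ` of `K`, for compatible Kolyvagin–Heegner data of conductors `m` and `mℓ` (all prime factors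
Kolyvagin of index `≥ M`), the `p^j`-multiples of the Kolyvagin class at `mℓ` lie in the Selmer local condition at `λ`
iff in the torsion local kernel, iff the same holds for the class at `m` — read with `E[p]` irreducible in place of
surjectivity. WHY IT MIGHT FAIL: expected to be an image-free port of McCallum §4, but the additive place `p ∣ N` and
the ring-class-field ramification at `ℓ` have not been checked in this reading by anyone.
[cite: McCallumLMS1991, §4 Prop. 4.4] [cite: Jetchev2008, Prop. 4.4, Rem. 6.2] -/
abbrev Sig.stub_prop44Irred : Prop :=
  ∀ (W : WeierstrassCurve ℚ) [W.IsElliptic] [W.IsGloballyMinimal] [NeZero (W.conductorNorm ℤ)],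
        ¬ W.HasCM →
        ∀ (K : Type) [Field K] [NumberField K], IsImaginaryQuadratic K →
        NumberField.discr K ≠ -3 → NumberField.discr K ≠ -4 →
        SatisfiesHeegnerHypothesis (W.conductorNorm ℤ) K →
        ∀ (p : ℕ) [Fact p.Prime], p ≠ 2 → W.HasIrreducibleModPGaloisRep p →
        ∀ (Dt : ModularParametrizationData W (W.conductorNorm ℤ)) (β : ℤ) (ι : K →+* ℂ)
          (M : ℕ), 1 ≤ M →
        ∀ (m l : ℕ), Squarefree (m * l) → l.Prime → ¬ l ∣ m →
          (∀ l' ∈ (m * l).primeFactors, Zhang2014.IsKolyvaginPrime (W.conductorNorm ℤ) W K p l' ∧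
            M ≤ Zhang2014.kolyvaginIndex W p l') →
        ∀ (d : KolyvaginHeegnerData Dt β ι m) (d' : KolyvaginHeegnerData Dt β ι (m * l)),
          (∀ l' ∈ m.primeFactors, ∀ (x : ringClassField K ι m) (x' : ringClassField K ι (m * l)),
            (x : ℂ) = x' → ((d'.σ l' x' : ringClassField K ι (m * l)) : ℂ) = (d.σ l' x : ℂ)) →
          (∀ s ∈ d.S, ∃ s' ∈ d'.S, ∀ (x : ringClassField K ι m) (x' : ringClassField K ι (m * l)),
            (x : ℂ) = x' → ((s' x' : ringClassField K ι (m * l)) : ℂ) = (s x : ℂ)) →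
          (∀ s' ∈ d'.S, ∃ s ∈ d.S, ∀ (x : ringClassField K ι m) (x' : ringClassField K ι (m * l)),
            (x : ℂ) = x' → ((s' x' : ringClassField K ι (m * l)) : ℂ) = (s x : ℂ)) →
          (∀ (x : ringClassField K ι m) (x' : ringClassField K ι (m * l)),
            (x : ℂ) = x' → d'.emb x' = d.emb x) →
        ∀ (v : HeightOneSpectrum (𝓞 K)), (l : 𝓞 K) ∈ v.asIdeal →
        ∀ (j : ℕ),
          (((p ^ j : ℕ) : ℤ) • d'.kolyvaginClass (Fact.out : p.Prime) M ∈
              selmerLocalKer (W.baseChange K) (v.adicCompletion K) ((p ^ M : ℕ) : ℤ) ↔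
            ((p ^ j : ℕ) : ℤ) • d'.kolyvaginClass (Fact.out : p.Prime) M ∈
              (W.baseChange K).torsionLocalKer (v.adicCompletion K) ((p ^ M : ℕ) : ℤ)) ∧
          (((p ^ j : ℕ) : ℤ) • d'.kolyvaginClass (Fact.out : p.Prime) M ∈
              (W.baseChange K).torsionLocalKer (v.adicCompletion K) ((p ^ M : ℕ) : ℤ) ↔
            ((p ^ j : ℕ) : ℤ) • d.kolyvaginClass (Fact.out : p.Prime) M ∈
              (W.baseChange K).torsionLocalKer (v.adicCompletion K) ((p ^ M : ℕ) : ℤ))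

/-! `stub_thm52ClosedLocalFacts` below is k8t-c4 g10's 20165 v6 candidate text BYTE-FOR-BYTE (docstring included), so the
stub is SHARED between 20165 v6 and 19941 v4: one proof, `--supports` both items. -/

/-- Statement of `stub_thm52ClosedLocalFacts` (NEW in v6, **hardest**; replaces v3–v5's `stub_thm52KernelGapsAddv`):
the conjunction of the EIGHT CLOSED, image-free, row-free statements from which k8t-c4 g10's
`JetchevIrreducibleReadingThm52.h63IRowObjectsAddv_of_closedLocalFacts` (p526159) proves the node `Sig.H63IRowObjectsAddv`
together with `stub_prop44Irred` — each conjunct VERBATIM a binder of bsd-jet's road-K end form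
`JET.jetchevDivisibilityCarrierMult_of_localFacts` (p517079), so every future discharge by `bsd-jet` ports by name:
(1) `hPT` Poitou–Tate duality for Selmer structures at every number field (named fact `poitouTate_selmerStructure_duality_conj`,
ARM P); (2) `h53` Gross 1991 Prop. 5.3 (Fricke sign schema); (3) `hGZ` [GZ86 III (3.1)] in the receptacle form (schema);
(4) `hloc` Jetchev Lemma 5.2 (i)(ii) (the `±`-parts of `H¹(K_λ, E[p^k])/Kum_λ` at a Kolyvagin prime have order `p^k`; bsd-jet
pv-1/read-1 (L1) line); (5) `h𝒯σ` the intrinsic transverse condition is `τ`-stable (Gross §3 dihedral; bsd-jet T2);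
(6) `h𝒯sd` it is Lagrangian (Howard 2004 Prop. 2.1.9 (ii); bsd-jet T1); (7) `htr` the classes `c_k(c)` are transverse at the
primes of `c` (Howard 2004 Lemma 2.7.3; bsd-jet completion layer); (8) `h49str` Jetchev Prop. 4.9 proper: the classes at `cℓ`
are STRINGENT at the places over the conductor (bsd-jet completion layer). DISCHARGED w.r.t. v5 (no longer displayed): `hCM1`,
`hCM2`, the structures `𝒯 𝒮 Qcar e′ C′` with `hT`/`hS`/`hQcar`, `hdual_q`, `hdual_ℓ`, `h49tr` (bsd-jet p506535–p516218 +
`kodairaNeron_isAddCyclic_forall`, ported p524630 / k9-c4 `…JetchevIrreducibleLocalFacts` / p526159). WHY IT MIGHT FAIL: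
(8) at an additive place `v ∣ p` of `K` is the x11b3 layer theorem only under `p ∤ c_p`; (1) is typed as a conjecture-shaped
named fact pending ARM P; (4)–(7) are local statements nobody has proved in this currency. Sources: bsd-jet
`Rank1ResidualJetCarrierMultEndForm.lean` (p517079), sheets PV2-J6-KERNEL ADDENDUM-4/5.
[cite: Jetchev2008, Lemma 5.2, Prop. 4.9, §3.1.2, Thm. 5.2 (p. 821)] [cite: GrossLMS1991, §3, Prop. 5.3]
[cite: GrossZagier1986, III (3.1)] [cite: Howard2004HeegnerKolyvagin, Prop. 2.1.9, Lemma 2.7.3] [cite: MilneADT2006, Ch. I, Thm. 4.10(b)] -/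
abbrev Sig.stub_thm52ClosedLocalFacts : Prop :=
    (∀ (K : Type) [Field K] [NumberField K], poitouTate_selmerStructure_duality_conj K) ∧
    (∀ (W : WeierstrassCurve ℚ) [W.IsElliptic] [NeZero (W.conductorNorm ℤ)]
      (K : Type) [Field K] [NumberField K]
      (Dt : ModularParametrizationData W (W.conductorNorm ℤ)) (β : ℤ) (ι : K →+* ℂ)
      [∀ j : ℕ, NumberField (ringClassField K ι j)],
      ∃ ε : ℤ, (ε = 1 ∨ ε = -1) ∧ ∀ (m : ℕ) (dm : KolyvaginHeegnerData Dt β ι m)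
        (τm : ringClassField K ι m ≃ₐ[ℚ] ringClassField K ι m),
        (∀ x : ringClassField K ι m, ((τm x : ringClassField K ι m) : ℂ) = starRingEnd ℂ x) →
        ∃ σ' ∈ ringClassGal ι m, IsOfFinAddOrder
          (pointGalHom W (ringClassField K ι m) τm dm.y -
            ε • pointGalHom W (ringClassField K ι m) σ' dm.y)) ∧
    (∀ (W : WeierstrassCurve ℚ) [W.IsElliptic] [NeZero (W.conductorNorm ℤ)]
      (K : Type) [Field K] [NumberField K] (p : ℕ) [Fact p.Prime]
      (Dt : ModularParametrizationData W (W.conductorNorm ℤ)) (β : ℤ) (ι : K →+* ℂ)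
      [∀ j : ℕ, NumberField (ringClassField K ι j)],
      ∃ n' : ℤ, IsCoprime (p : ℤ) n' ∧ ∀ (m : ℕ) (dm : KolyvaginHeegnerData Dt β ι m)
        (γ : ringClassField K ι m ≃ₐ[ℚ] ringClassField K ι m), γ ∈ ringClassGal ι m →
        ∀ v : HeightOneSpectrum (𝓞 K), ¬ (W.baseChange K).HasGoodReductionAt v →
          n' • pointsMap (W.baseChange K) (v.adicCompletion K)
              (dm.toGeomPoints (pointGalHom W (ringClassField K ι m) γ dm.y)) ∈
            E0Receptacle (W.baseChange K) v ∧
          ∀ (ℓ : ℕ), ℓ ∈ m.primeFactors → ∀ (dm' : KolyvaginHeegnerData Dt β ι (m / ℓ))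
            (hle : ringClassField K ι (m / ℓ) ≤ ringClassField K ι m),
            n' • pointsMap (W.baseChange K) (v.adicCompletion K)
                (dm.toGeomPoints (pointGalHom W (ringClassField K ι m) γ
                  (WeierstrassCurve.Affine.Point.map (W' := W)
                    ((RingClassField.inclusion ι hle).restrictScalars ℚ) dm'.y))) ∈
              E0Receptacle (W.baseChange K) v) ∧
    (∀ (W : WeierstrassCurve ℚ) [W.IsElliptic] [W.IsGloballyMinimal]
      (K : Type) [Field K] [NumberField K], IsImaginaryQuadratic K →
      ∀ (τ : K ≃ₐ[ℚ] K), τ ≠ 1 → ∀ (p k : ℕ) [Fact p.Prime], p ≠ 2 → 1 ≤ k →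
      ∀ (ℓ : ℕ), Zhang2014.IsKolyvaginPrime (W.conductorNorm ℤ) W K p ℓ →
        k ≤ Zhang2014.kolyvaginIndex W p ℓ →
      ∀ (v : HeightOneSpectrum (𝓞 K)), (ℓ : 𝓞 K) ∈ v.asIdeal → ∀ (hfix : τ • v = v)
        (s : ℤ), s = 1 ∨ s = -1 →
      ((W.baseChange K).kummerSelmerStructure ((p ^ k : ℕ) : ℤ) (Sum.inr v)).relIndex
        ((conjActPlace W τ ((p ^ k : ℕ) : ℤ) hfix - s • AddMonoidHom.id _).ker) = p ^ k) ∧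
    (∀ (W : WeierstrassCurve ℚ) [W.IsElliptic] [W.IsGloballyMinimal]
      (K : Type) [Field K] [NumberField K], IsImaginaryQuadratic K →
      ∀ (ι : K →+* ℂ) [∀ j : ℕ, NumberField (ringClassField K ι j)] (τ : K ≃ₐ[ℚ] K), τ ≠ 1 →
      ∀ (p k : ℕ) [Fact p.Prime], p ≠ 2 →
      ∀ (c : ℕ), Squarefree c → (∀ ℓ ∈ c.primeFactors,
        Zhang2014.IsKolyvaginPrime (W.conductorNorm ℤ) W K p ℓ ∧ k ≤ Zhang2014.kolyvaginIndex W p ℓ) →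
      ∀ (𝒯 : SelmerStructure ((W.baseChange K).torsionGaloisModule ((p ^ k : ℕ) : ℤ))),
      (∀ v : HeightOneSpectrum (𝓞 K), 𝒯 (Sum.inr v) =
        ⨅ ℓ ∈ c.primeFactors.filter (fun ℓ : ℕ ↦ ((ℓ : ℕ) : 𝓞 K) ∈ v.asIdeal),
          ⨅ (w' : HeightOneSpectrum (𝓞 (ringClassField K ι ℓ))) (_ : w'.asIdeal.LiesOver v.asIdeal),
            letI := (adicCompletionOfLiesOver K (ringClassField K ι ℓ) v w').toAlgebra
            transverseSubgroup (GaloisRep.toLocal v ((W.baseChange K).torsionGaloisModule ((p ^ k : ℕ) : ℤ)))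
              (w'.adicCompletion (ringClassField K ι ℓ))) →
      ∀ (v w : HeightOneSpectrum (𝓞 K)) (h : τ • v = w), v ∈ placesDividing K c →
      ∀ x : galoisCohomology (((W.baseChange K).torsionGaloisModule ((p ^ k : ℕ) : ℤ)).toLocal
        (Sum.inr v : Place K)) 1,
      x ∈ 𝒯 (Sum.inr v) → conjActPlace W τ ((p ^ k : ℕ) : ℤ) h x ∈ 𝒯 (Sum.inr w)) ∧
    (∀ (W : WeierstrassCurve ℚ) [W.IsElliptic] [W.IsGloballyMinimal]
      (K : Type) [Field K] [NumberField K], IsImaginaryQuadratic K →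
      ∀ (ι : K →+* ℂ) [∀ j : ℕ, NumberField (ringClassField K ι j)]
      (p k : ℕ) [Fact p.Prime] [NeZero (p ^ k)] [Finite (geomTorsion (W.baseChange K) ((p ^ k : ℕ) : ℤ))],
      p ≠ 2 → ∀ (c : ℕ), Squarefree c → (∀ ℓ ∈ c.primeFactors,
        Zhang2014.IsKolyvaginPrime (W.conductorNorm ℤ) W K p ℓ ∧ k ≤ Zhang2014.kolyvaginIndex W p ℓ) →
      ∀ (𝒯 : SelmerStructure ((W.baseChange K).torsionGaloisModule ((p ^ k : ℕ) : ℤ))),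
      (∀ v : HeightOneSpectrum (𝓞 K), 𝒯 (Sum.inr v) =
        ⨅ ℓ ∈ c.primeFactors.filter (fun ℓ : ℕ ↦ ((ℓ : ℕ) : 𝓞 K) ∈ v.asIdeal),
          ⨅ (w' : HeightOneSpectrum (𝓞 (ringClassField K ι ℓ))) (_ : w'.asIdeal.LiesOver v.asIdeal),
            letI := (adicCompletionOfLiesOver K (ringClassField K ι ℓ) v w').toAlgebra
            transverseSubgroup (GaloisRep.toLocal v ((W.baseChange K).torsionGaloisModule ((p ^ k : ℕ) : ℤ)))
              (w'.adicCompletion (ringClassField K ι ℓ))) →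
      ∀ (e : geomTorsion (W.baseChange K) ((p ^ k : ℕ) : ℤ) →
          geomTorsion (W.baseChange K) ((p ^ k : ℕ) : ℤ) → AlgebraicClosure K)
        (hμ : ∀ S T, e S T ^ (p ^ k) = 1)
        (hadd₁ : ∀ S₁ S₂ T, e (S₁ + S₂) T = e S₁ T * e S₂ T)
        (hadd₂ : ∀ S T₁ T₂, e S (T₁ + T₂) = e S T₁ * e S T₂)
        (hgal : ∀ (g : absoluteGaloisGroup K) (S T : geomTorsion (W.baseChange K) ((p ^ k : ℕ) : ℤ)),
          g • e S T = e (g • S) (g • T)),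
      (∀ T, e T T = 1) → (∀ T, (∀ S, e S T = 1) → T = 0) →
      ∀ inv : LocalInvariants K (p ^ k), inv.IsPerfect → ∀ v ∈ placesDividing K c,
      inv.dualTransported 𝒯 (weilDualIntertwining (W.baseChange K) (p ^ k) e hμ hadd₁ hadd₂ hgal)
        (Sum.inr v) = 𝒯 (Sum.inr v)) ∧
    (∀ (W : WeierstrassCurve ℚ) [W.IsElliptic] [W.IsGloballyMinimal] [NeZero (W.conductorNorm ℤ)]
      (K : Type) [Field K] [NumberField K], IsImaginaryQuadratic K →
      ∀ (p : ℕ) [Fact p.Prime], p ≠ 2 →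
      ∀ (Dt : ModularParametrizationData W (W.conductorNorm ℤ)) (β : ℤ) (ι : K →+* ℂ)
        [∀ j : ℕ, NumberField (ringClassField K ι j)]
        (k : ℕ) (c : ℕ), Squarefree c →
        (∀ ℓ ∈ c.primeFactors, Zhang2014.IsKolyvaginPrime (W.conductorNorm ℤ) W K p ℓ ∧
          k ≤ Zhang2014.kolyvaginIndex W p ℓ) →
      ∀ (d : KolyvaginHeegnerData Dt β ι c), ∀ ℓ ∈ c.primeFactors,
        (d.kolyvaginClass (Fact.out : p.Prime) k :
          galoisCohomology ((W.baseChange K).torsionGaloisModule ((p ^ k : ℕ) : ℤ)) 1) ∈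
          transverseKer W K ι ((p ^ k : ℕ) : ℤ) ℓ) ∧
    (∀ (W : WeierstrassCurve ℚ) [W.IsElliptic] [W.IsGloballyMinimal] [NeZero (W.conductorNorm ℤ)]
      (K : Type) [Field K] [NumberField K], IsImaginaryQuadratic K →
      SatisfiesHeegnerHypothesis (W.conductorNorm ℤ) K →
      ∀ (p : ℕ) [Fact p.Prime], p ≠ 2 →
      ∀ (Dt : ModularParametrizationData W (W.conductorNorm ℤ)) (β : ℤ) (ι : K →+* ℂ)
        [∀ j : ℕ, NumberField (ringClassField K ι j)]
        (k : ℕ) (hn : ((p ^ k : ℕ) : ℤ) ≠ 0) (c : ℕ), Squarefree c →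
        (∀ ℓ ∈ c.primeFactors, Zhang2014.IsKolyvaginPrime (W.conductorNorm ℤ) W K p ℓ ∧
          k ≤ Zhang2014.kolyvaginIndex W p ℓ) →
      ∀ (q : HeightOneSpectrum (𝓞 K)), ((W.conductorNorm ℤ : ℕ) : 𝓞 K) ∈ q.asIdeal →
      ∀ (ℓ : ℕ), Zhang2014.IsKolyvaginPrime (W.conductorNorm ℤ) W K p ℓ →
        k ≤ Zhang2014.kolyvaginIndex W p ℓ → ℓ ∉ c.primeFactors →
      ∀ (d' : KolyvaginHeegnerData Dt β ι (c * ℓ)),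
        galoisCohomology.localization ((W.baseChange K).torsionGaloisModule ((p ^ k : ℕ) : ℤ))
            (Sum.inr q) 1 (d'.kolyvaginClass (Fact.out : p.Prime) k) ∈ stringentFamily W K hn (Sum.inr q))

/-- S2p — at-`p` divisibility at conductor level (the `hDp` schema of p518161; PROVED below from four stubs, not a stub):
on a frame of level `N_E` whose conductor-`1` derived point has infinite order, every derived Heegner point `P_n` is
`p^s`-divisible in `E(K[n])` for all `s ≤ ord_p c_p(E)` — the `q = p` share of Jetchev's Conj. 1.3, irreducible reading
of bsd-jet's K4 `JET.JetchevDivisibilityCarrierAdd`. [cite: Jetchev2008, Conj. 1.3, Thm. 1.4] -/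
abbrev Sig.S2pDivisibilityAtP : Prop :=
  ∀ (W : WeierstrassCurve ℚ) [W.IsElliptic] [W.IsGloballyMinimal] [NeZero (W.conductorNorm ℤ)],
      ¬ W.HasCM →
      ∀ (K : Type) [Field K] [NumberField K], IsImaginaryQuadratic K →
      NumberField.discr K ≠ -3 → NumberField.discr K ≠ -4 →
      SatisfiesHeegnerHypothesis (W.conductorNorm ℤ) K →
      ∀ (p : ℕ) [Fact p.Prime], p ≠ 2 → W.analyticRank = 0 → Addv W p → 0 ≤ padicValRat p W.j →
      W.HasIrreducibleModPGaloisRep p → ¬ (∀ n : ℕ, W.HasSurjectiveModNGaloisRep (p ^ n : ℕ)) →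
      (∃ Dt : ModularParametrizationData W (W.conductorNorm ℤ),
        (∀ z ∈ Dt.L.lattice, ∃ w ∈ periodLattice Dt.f, z = (Dt.c : ℂ) * w) ∧ ¬ (p : ℤ) ∣ Dt.c) →
      ∀ (Dt : ModularParametrizationData W (W.conductorNorm ℤ)) (β : ℤ) (ι : K →+* ℂ)
        (d₁ : KolyvaginHeegnerData Dt β ι 1), ¬ IsOfFinAddOrder d₁.derivedPoint →
      ∀ (s : ℕ), s ≤ padicValNat p ((W.baseChange ℚ_[p]).localTamagawaNumber ℤ_[p]) →
      ∀ (n : ℕ) (d : KolyvaginHeegnerData Dt β ι n), Squarefree n →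
        (∀ ℓ ∈ n.primeFactors, Zhang2014.IsKolyvaginPrime (W.conductorNorm ℤ) W K p ℓ ∧
          s ≤ Zhang2014.kolyvaginIndex W p ℓ) →
        ∃ Q : (W.baseChange (ringClassField K ι n)).toAffine.Point,
          ((p ^ s : ℕ) : ℤ) • Q = d.derivedPoint

/-- Statement of `stub_gaussianSupplement` (idle for the route; DROP by restating the crux with `NumberField.discr K ≠ -4`):
the crux body at the Gaussian field `d_K = −4` — the instances S1 (MN19 Thm. 0.7, printed for `D_K ≠ −3, −4`) does not
cover and the J08 road never uses (`p ∣ N` split in `ℚ(i)` forces `p ≡ 1 (4)`, so `ord_p c_p = 0` there and the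
content is the MN19 Thm. 0.3-type bound at `ℚ(i)`, Gross's `u_K = 2` normalisation). = `h4` of p518161 §3.
[cite: MatarNekovar2019, Thm. 0.3, Thm. 0.7 (D_K ≠ −3, −4)] [cite: GrossLMS1991, §3 (u_K)] -/
abbrev Sig.stub_gaussianSupplement : Prop :=
  ∀ (N : ℕ) [NeZero N] (W : WeierstrassCurve ℚ) [W.IsElliptic] [W.IsGloballyMinimal]
    (K : Type) [Field K] [NumberField K],
    IsImaginaryQuadratic K → NumberField.discr K = -4 → SatisfiesHeegnerHypothesis N K →
    ∀ (p : ℕ) [Fact p.Prime], p ≠ 2 → W.analyticRank = 0 → Addv W p → 0 ≤ padicValRat p W.j →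
    ¬ W.HasCM → W.HasIrreducibleModPGaloisRep p → ¬ (∀ n : ℕ, W.HasSurjectiveModNGaloisRep (p ^ n : ℕ)) →
    (∃ Dt : ModularParametrizationData W N,
      (∀ z ∈ Dt.L.lattice, ∃ w ∈ periodLattice Dt.f, z = (Dt.c : ℂ) * w) ∧ ¬ (p : ℤ) ∣ Dt.c) →
    ∀ {P : (W.baseChange K).toAffine.Point}, IsHeegnerPoint N W K P → ¬ IsOfFinAddOrder P → p ∣ N →
    padicValNat p (Nat.card (AddCommGroup.primaryComponent (W.baseChange K).sha p)) +
        2 * padicValNat p ((W.baseChange ℚ_[p]).localTamagawaNumber ℤ_[p]) ≤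
      2 * padicValNat p (AddSubgroup.zmultiples P).index

/-- Statement of `stub_publishedInputsHeegner` (cite; the K9 route's held conjunction, item 19914). -/
abbrev Sig.stub_publishedInputsHeegner : Prop :=
  Summit.BirchSwinnertonDyer.BirchSwinnertonDyer.Theses.KatoDescentPotSupersingular.PublishedInputsHeegner


/-- S1 — registered stub of 20165 (shared verbatim). -/
theorem stub_structureIrred : Sig.stub_structureIrred := by
  sorry

/-- McCallum Prop. 5.2, irreducible reading, PRIMED (`p ∣ N_E`) — 20165 v5's stub (shared verbatim). -/
theorem stub_prop52IrredP : Sig.stub_prop52IrredP := by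
  sorry

/-- Jetchev Prop. 5.3, irreducible reading, PRIMED (`p ∣ N_E`) — 20165 v5's stub (shared verbatim). -/
theorem stub_coreVertexExistenceIrredP : Sig.stub_coreVertexExistenceIrredP := by
  sorry

/-- McCallum Prop. 4.4, irreducible reading — registered stub of 20165 (shared verbatim). -/
theorem stub_prop44Irred : Sig.stub_prop44Irred := by
  sorry

/-- bsd-jet's closed end-form statements (shared with 20165 v6 and bsd-jet's register). -/
theorem stub_thm52ClosedLocalFacts : Sig.stub_thm52ClosedLocalFacts := by
  sorry

/-- The K9 route's held `PublishedInputsHeegner` (cite). -/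
theorem stub_publishedInputsHeegner : Sig.stub_publishedInputsHeegner := by
  sorry

/-- The idle `d_K = −4` supplement (drop by restating the crux). -/
theorem stub_gaussianSupplement : Sig.stub_gaussianSupplement := by
  sorry

/-- **S2p (at-`p` divisibility at conductor level) is PROVED from four stubs** (p520230 §1 ∘ §2, `hRCF` discharged by
`JET.numberField_ringClassField`). A REAL proof. [cite: Jetchev2008, Thm. 1.4 (proof), Thm. 5.2, Prop. 5.3] -/
theorem S2pDivisibilityAtP_of (h52 : Sig.stub_prop52IrredP) (hCV : Sig.stub_coreVertexExistenceIrredP)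
    (h44 : Sig.stub_prop44Irred) (hLF : Sig.stub_thm52ClosedLocalFacts) :
    Sig.S2pDivisibilityAtP :=
  WildJetchevBoundAtPCoreVertexBridgePrimed.divisibilityAtP_of_prop52IrredP_of_coreVertexExistenceIrredP_of_thm63AtP
    h52 hCV (fun K _ _ ι hK k ↦ Summit.BirchSwinnertonDyer.Rank1Residual.JET.numberField_ringClassField K hK ι k)
    (WildJetchevBoundAtPClosedLocalFacts.thm63AtP_of_closedLocalFactsAtP h44 hLF.1 hLF.2.1 hLF.2.2.1 hLF.2.2.2.1
      hLF.2.2.2.2.1 hLF.2.2.2.2.2.1 hLF.2.2.2.2.2.2.1 hLF.2.2.2.2.2.2.2)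

/-- **The crux from the eight stubs** (p518161 §3 fed with S1, the proved S2p, PIH and the supplement), concluding the
K9 route decl BY NAME. A REAL proof; sorries only inside the stubs. [cite: Jetchev2008, Cor. 1.5 (p. 812)]
[cite: MatarNekovar2019, Thm. 0.7, §0.11] -/
theorem WildJetchevBoundAtP_of (hS : Sig.stub_structureIrred) (h52 : Sig.stub_prop52IrredP)
    (hCV : Sig.stub_coreVertexExistenceIrredP) (h44 : Sig.stub_prop44Irred)
    (hKG : Sig.stub_thm52ClosedLocalFacts) (hH : Sig.stub_publishedInputsHeegner) (h4 : Sig.stub_gaussianSupplement) :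
    Summit.BirchSwinnertonDyer.BirchSwinnertonDyer.Theses.KatoDescentPotSupersingular.WildJetchevBoundAtP :=
  WildJetchevBoundAtPOfStubs.wildJetchevBoundAtP_of_structureIrred_of_divisibilityAtP_of_gaussianSupplement hS
    (S2pDivisibilityAtP_of h52 hCV h44 hKG) hH h4

/-- Sanity composition with the sorried stubs. -/
theorem wildJetchevBoundAtP_of_stubs :
    Summit.BirchSwinnertonDyer.BirchSwinnertonDyer.Theses.KatoDescentPotSupersingular.WildJetchevBoundAtP :=
  WildJetchevBoundAtP_of stub_structureIrred stub_prop52IrredP stub_coreVertexExistenceIrredP stub_prop44Irred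
    stub_thm52ClosedLocalFacts stub_publishedInputsHeegner stub_gaussianSupplement

end Summit.BirchSwinnertonDyer.BirchSwinnertonDyer.Cruxes.WildJetchevBoundAtP.BirthV4

end
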